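/-
Origin: expansion seat `planner-pub-hodgecm-pv07-g5-0`, handover #6 2026-08-18T14:44Z (md5 b19c5056219e1b10fd32ba02e69dd804; NEW additive leaf; ONE import rewrite by the generic ^import Pv[0-9]+g[0-9]+\. -> import HodgeCM.PerL34. rule: Pv13g5.GenuineSchrodingerSchwartzDense (pv13-g5 RUN-30 row 1f97a611); land AFTER HodgeCM/PerL34/GenuineSchrodingerSchwartzDense.lean is in the tree (RUN 30)) (`HOME/pub-hodgecm-pv07-g5/lean/Pv07g5/GenuineSchrodingerSchwartzBox.lean`, md5 b19c5056, 407 lines);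
landed by the gen-8 packager in gate run 31 as `HodgeCM/PerL34/GenuineSchrodingerSchwartzBox.lean` (import ^import Pv13g5\.GenuineSchrodingerSchwartzDense[ \t]*$→import HodgeCM.PerL34.GenuineSchrodingerSchwartzDense ×1).
-/
/-
Copyright (c) 2026. All rights reserved.
Released under Apache 2.0 license as described in the file LICENSE.
Authors: unit pub-hodgecm-pv07-g5 (DAG-NODE PROVER #07, seam S3, torus side).

# HodgeCM/PerL34/GenuineSchrodingerSchwartzBox.lean — `𝒮(X)` is spanned by the indicators of
# FACTORIZABLE boxes `∏_v C_v` (the restricted-tensor description of the Schwartz–Bruhat space of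
# the genuine split Schrödinger model)
-/
import Summits.HodgeConjecture.HodgeCM.PerL34.GenuineSchrodingerSchwartzDense_2

/-!
# The Schwartz–Bruhat space of `X` is spanned by factorizable vectors

`X = Space L = Πʳ_{v split} [(L⁺_v)³, 𝒪_v³]` is the genuine split Schrödinger space of
`GenuineSchrodingerModel` (RUN 29) and `𝒮(X) = Coeff.schwartzBruhat L ⊆ L²(X)` its Schwartz–Bruhat
space (`GenuineSchrodingerSchwartz`, pv07-g5 #5: the span of the indicator vectors of the compact open
subsets of `X`; identified with the classes of the locally constant compactly supported functions and
proved dense in `GenuineSchrodingerSchwartzDense`, pv13-g5 #6).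

In print the Schwartz–Bruhat space of a restricted product is, by definition (Bruhat; Weil 1964
no. 11, no. 29; PerL v5 tex ll. 259–263, 600–616: `θ_φ` for FACTORIZABLE `φ = ⊗_v φ_v`), the
restricted tensor product `⊗'_v 𝒮((L⁺_v)³)` with respect to the vectors `1_{𝒪_v³}`: the span of the
factorizable functions `u ↦ ∏_v φ_v(u_v)` with `φ_v` locally constant compactly supported and
`φ_v = 1_{𝒪_v³}` for almost all `v`.  This file proves that the intrinsic `𝒮(X)` of the package IS
that span:

* §1 cosets `x + B_k` of the level balls of `GenuineSchrodingerRigid` §2 are equal or disjoint and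
  decrease in `k`; **`exists_eq_biUnion_ballCoset`**: every compact open `A ⊆ X` is a finite union of
  cosets of ONE level ball `B_k` (so a finite DISJOINT union of compact open cosets).
* §2 **`Coeff.schwartzBruhat_eq_span_ballCoset`**: `𝒮(X)` is the `ℂ`-span of the indicator vectors
  `1_{x + B_k}` (`x ∈ X`, `k ∈ ℕ`) — finite additivity of `indicatorConstLp` over the disjoint
  decomposition of §1.
* §3 restricted boxes: `rbox L C = {u | ∀ v, u_v ∈ C_v}` for a family `C = (C_v)`; it is
  FACTORIZABLE (`IsFactorizable`) when every `C_v ⊆ (L⁺_v)³` is compact open and `C_v = 𝒪_v³` for all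
  but finitely many `v`.  A factorizable box is compact (continuous image of the compact `∏_v C_v`
  through a principal restricted product) and open (`RestrictedProduct.isOpen_forall_imp_mem`); every
  level-ball coset is a factorizable box (`ballCoset_eq_rbox`, `isFactorizable_closedBall`: the factor
  at `v` is the closed ball `closedBall x_v (rad k v)`, which is `𝒪_v³` as soon as `x_v ∈ 𝒪_v³` and the
  place index is `≥ k` — ultrametric balls); and the indicator function of a factorizable box is the
  (finite) product of the local indicators, `1_{rbox C}(u) = ∏ᶠ_v 1_{C_v}(u_v)` (`indicator_rbox_apply`)
  — the dictionary with the pure tensors `⊗_v 1_{C_v}`.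
* §4 **`Coeff.schwartzBruhat_eq_span_rbox`**: `𝒮(X)` is the `ℂ`-span of the indicator vectors of the
  factorizable boxes.  Since every `φ_v ∈ 𝒮((L⁺_v)³)` is a finite combination of indicators of compact
  open subsets of `(L⁺_v)³`, this is exactly print's `𝒮(X) = ⊗'_v 𝒮((L⁺_v)³)` read inside `L²(X)`.

ABSOLUTE RULE.  Nothing is cited and nothing is posited: every statement below is kernel-proved from
Mathlib, the landed package, pv13-g5's `GenuineSchrodingerRigid` / `GenuineSchrodingerSchwartzDense`
and this seat's `GenuineSchrodingerSchwartz` (all RUN 30).  The file is an additive leaf: it replaces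
nothing and nothing imports it.
-/

set_option autoImplicit false

noncomputable section

open MeasureTheory MeasureTheory.Measure Set Metric Function Complex Topology Filter
open scoped RestrictedProduct InnerProductSpace NNReal ENNReal Pointwise

namespace HodgeCM.PerL34.PureTensor.SchrodingerModel

open HodgeCM.PerL34.LocalFactors HodgeCM.PerL34.LocalFactors.DilationModel
open HodgeCM.PerL34.IdelePlaces NumberField IsDedekindDomain

attribute [local instance] LocalFactors.DilationModel.Adic.nontriviallyNormedField
  LocalFactors.DilationModel.Adic.properSpace

variable {L : Type} [Field L] [NumberField L] [IsCMField L]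

/-! ## §1  Level-ball cosets: equal or disjoint; compact open sets are finite unions of cosets -/

/-- a coset of `B_k` through a point of the coset `x + B_k` lies in it -/
theorem ballCoset_subset_of_mem {x z : Space L} {k : ℕ} (hz : z ∈ ballCoset L x k) :
    ballCoset L z k ⊆ ballCoset L x k := by
  rintro _ ⟨w, hw, rfl⟩
  obtain ⟨v, hv, rfl⟩ := hz
  exact ⟨v + w, (levelBall L k).add_mem hv hw, (add_assoc x v w).symm⟩

/-- the coset `x + B_k` is the coset of each of its points -/
theorem ballCoset_eq_ballCoset_of_mem {x z : Space L} {k : ℕ} (hz : z ∈ ballCoset L x k) :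
    ballCoset L z k = ballCoset L x k := by
  refine (ballCoset_subset_of_mem hz).antisymm ?_
  obtain ⟨v, hv, rfl⟩ := hz
  exact ballCoset_subset_of_mem ⟨-v, (levelBall L k).neg_mem hv, by
    show x + v + -v = x
    exact add_neg_cancel_right x v⟩

/-- **two cosets of the same level ball are equal or disjoint** -/
theorem ballCoset_eq_or_disjoint (x y : Space L) (k : ℕ) :
    ballCoset L x k = ballCoset L y k ∨ Disjoint (ballCoset L x k) (ballCoset L y k) := by
  refine (Set.disjoint_or_nonempty_inter (ballCoset L x k) (ballCoset L y k)).symm.imp (fun h => ?_) id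
  obtain ⟨z, hzx, hzy⟩ := h
  rw [← ballCoset_eq_ballCoset_of_mem hzx, ← ballCoset_eq_ballCoset_of_mem hzy]

/-- the cosets through a point decrease with the level -/
theorem ballCoset_subset_of_le (x : Space L) {k j : ℕ} (hkj : k ≤ j) : ballCoset L x j ⊆ ballCoset L x k :=
  Set.image_mono (levelBall_antitone L hkj)

/-- **every compact open subset of `X` is a finite union of cosets of ONE level ball `B_k`**: each
point of `A` has a coset inside `A` (`exists_ballCoset_subset`); finitely many of them cover `A`
(compactness); at the maximum `k` of their levels `A + B_k ⊆ A`, so `A` is a union of `B_k`-cosets, and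
finitely many of these (compactness again) already cover. -/
theorem exists_eq_biUnion_ballCoset {A : Set (Space L)} (hA : IsCompact A) (hAo : IsOpen A) :
    ∃ (k : ℕ) (t : Finset (Space L)), A = ⋃ y ∈ t, ballCoset L y k := by
  classical
  have hex : ∀ x ∈ A, ∃ k, ballCoset L x k ⊆ A := fun x hx =>
    exists_ballCoset_subset (hAo.mem_nhds hx)
  let kf : Space L → ℕ := fun x => if hx : x ∈ A then (hex x hx).choose else 0
  have hkf : ∀ x ∈ A, ballCoset L x (kf x) ⊆ A := fun x hx => by
    simp only [kf, dif_pos hx]; exact (hex x hx).choose_spec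
  obtain ⟨t₀, ht₀A, hcover⟩ :=
    hA.elim_nhds_subcover (fun x => ballCoset L x (kf x)) fun x _ => ballCoset_mem_nhds x (kf x)
  -- the common level
  have hstab : ∀ y ∈ A, ballCoset L y (t₀.sup kf) ⊆ A := by
    intro y hy
    obtain ⟨x, hx, hyx⟩ := Set.mem_iUnion₂.1 (hcover hy)
    calc ballCoset L y (t₀.sup kf) ⊆ ballCoset L y (kf x) := ballCoset_subset_of_le y (Finset.le_sup hx)
      _ ⊆ ballCoset L x (kf x) := ballCoset_subset_of_mem hyx
      _ ⊆ A := hkf x (ht₀A x hx)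
  obtain ⟨t, htA, hcov⟩ :=
    hA.elim_nhds_subcover (fun y => ballCoset L y (t₀.sup kf)) fun y _ => ballCoset_mem_nhds y _
  exact ⟨t₀.sup kf, t, hcov.antisymm (Set.iUnion₂_subset fun y hy => hstab y (htA y hy))⟩

/-! ## §2  `𝒮(X)` is spanned by the indicator vectors of the level-ball cosets -/

namespace Coeff

/-- proof-irrelevance of the set data of `indCO` -/
theorem indCO_congr {A B : Set (Space L)} (h : A = B) (hA : IsCompact A) (hA' : IsOpen A)
    (hB : IsCompact B) (hB' : IsOpen B) : indCO L A hA hA' = indCO L B hB hB' := by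
  subst h; rfl

/-- finite additivity: the indicator vector of a finite DISJOINT union of sets of finite measure lies in
any submodule containing the indicator vectors of the pieces -/
theorem indicatorConstLp_biUnion_mem (W : Submodule ℂ (Lp ℂ 2 (μ L))) (𝒞 : Finset (Set (Space L)))
    (hm : ∀ c ∈ 𝒞, MeasurableSet c) (hμ : ∀ c ∈ 𝒞, μ L c ≠ ∞)
    (hdisj : (𝒞 : Set (Set (Space L))).PairwiseDisjoint id)
    (hW : ∀ c ∈ 𝒞, ∀ (hmc : MeasurableSet c) (hμc : μ L c ≠ ∞), indicatorConstLp 2 hmc hμc (1 : ℂ) ∈ W)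
    (hmU : MeasurableSet (⋃ c ∈ 𝒞, c)) (hμU : μ L (⋃ c ∈ 𝒞, c) ≠ ∞) :
    indicatorConstLp 2 hmU hμU (1 : ℂ) ∈ W := by
  classical
  induction 𝒞 using Finset.induction_on with
  | empty =>
    have h0 : (⋃ c ∈ (∅ : Finset (Set (Space L))), c) = (∅ : Set (Space L)) := by simp
    rw [indicatorConstLp_congr_set h0 hmU hμU MeasurableSet.empty (by simp) 1, indicatorConstLp_empty]
    exact W.zero_mem
  | insert a s ha ih =>
    have hU : (⋃ c ∈ insert a s, c) = a ∪ ⋃ c ∈ s, c := Finset.set_biUnion_insert a s (fun c => c)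
    have hma : MeasurableSet a := hm a (Finset.mem_insert_self a s)
    have hμa : μ L a ≠ ∞ := hμ a (Finset.mem_insert_self a s)
    have hms : MeasurableSet (⋃ c ∈ s, c) :=
      MeasurableSet.biUnion s.countable_toSet fun c hc => hm c (Finset.mem_insert_of_mem hc)
    have hμs : μ L (⋃ c ∈ s, c) ≠ ∞ :=
      (measure_biUnion_lt_top s.finite_toSet fun c hc =>
        (hμ c (Finset.mem_insert_of_mem hc)).lt_top).ne
    have hdisj' : Disjoint a (⋃ c ∈ s, c) := by
      refine Set.disjoint_iUnion₂_right.2 fun c hc => ?_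
      have hac : a ≠ c := fun h => ha (h ▸ hc)
      exact hdisj (Finset.mem_coe.2 (Finset.mem_insert_self a s))
        (Finset.mem_coe.2 (Finset.mem_insert_of_mem hc)) hac
    rw [indicatorConstLp_congr_set hU hmU hμU (hma.union hms) (by finiteness) 1,
      indicatorConstLp_disjoint_union hma hms hμa hμs hdisj' (1 : ℂ)]
    refine W.add_mem (hW a (Finset.mem_insert_self a s) hma hμa) ?_
    exact ih (fun c hc => hm c (Finset.mem_insert_of_mem hc))
      (fun c hc => hμ c (Finset.mem_insert_of_mem hc))
      (hdisj.subset (Finset.coe_subset.2 (Finset.subset_insert a s)))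
      (fun c hc => hW c (Finset.mem_insert_of_mem hc)) hms hμs

variable (L) in
/-- the indicator vectors `1_{x + B_k}` of the level-ball cosets -/
def indBallCoset (p : Space L × ℕ) : Lp ℂ 2 (μ L) :=
  indCO L (ballCoset L p.1 p.2) (isCompact_ballCoset p.1 p.2) (isOpen_ballCoset p.1 p.2)

/-- (Ported verbatim from the HodgeCMPerL package; no docstring in the source.) -/
theorem indBallCoset_mem_schwartzBruhat (p : Space L × ℕ) : indBallCoset L p ∈ schwartzBruhat L :=
  Submodule.subset_span ⟨⟨ballCoset L p.1 p.2, isCompact_ballCoset p.1 p.2, isOpen_ballCoset p.1 p.2⟩,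
    rfl⟩

/-- the indicator vector of a compact open set lies in the span of the coset indicator vectors -/
theorem indCO_mem_span_indBallCoset {A : Set (Space L)} (hA : IsCompact A) (hAo : IsOpen A) :
    indCO L A hA hAo ∈ Submodule.span ℂ (Set.range (indBallCoset L)) := by
  classical
  obtain ⟨k, t, hAt⟩ := exists_eq_biUnion_ballCoset hA hAo
  set W : Submodule ℂ (Lp ℂ 2 (μ L)) := Submodule.span ℂ (Set.range (indBallCoset L))
  let 𝒞 : Finset (Set (Space L)) := t.image fun y => ballCoset L y k
  have hU : (⋃ c ∈ 𝒞, c) = A := by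
    rw [hAt]; exact Finset.set_biUnion_finset_image
  have hgen : ∀ c ∈ 𝒞, ∃ y, c = ballCoset L y k := fun c hc => by
    obtain ⟨y, -, rfl⟩ := Finset.mem_image.1 hc; exact ⟨y, rfl⟩
  have hmU : MeasurableSet (⋃ c ∈ 𝒞, c) := by rw [hU]; exact hAo.measurableSet
  have hμU : μ L (⋃ c ∈ 𝒞, c) ≠ ∞ := by rw [hU]; exact hA.measure_lt_top.ne
  have key : indicatorConstLp 2 hmU hμU (1 : ℂ) ∈ W := by
    refine indicatorConstLp_biUnion_mem W 𝒞 (fun c hc => ?_) (fun c hc => ?_) ?_ (fun c hc hmc hμc => ?_)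
      hmU hμU
    · obtain ⟨y, rfl⟩ := hgen c hc; exact (isOpen_ballCoset y k).measurableSet
    · obtain ⟨y, rfl⟩ := hgen c hc; exact (isCompact_ballCoset y k).measure_lt_top.ne
    · intro c hc c' hc' hne
      obtain ⟨y, rfl⟩ := hgen c hc
      obtain ⟨y', rfl⟩ := hgen c' hc'
      exact (ballCoset_eq_or_disjoint y y' k).resolve_left hne
    · obtain ⟨y, rfl⟩ := hgen c hc
      exact Submodule.subset_span ⟨(y, k), rfl⟩
  have hAeq : indCO L A hA hAo = indicatorConstLp 2 hmU hμU (1 : ℂ) :=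
    indicatorConstLp_congr_set hU.symm _ _ _ _ 1
  rw [hAeq]; exact key

variable (L) in
/-- **`𝒮(X)` is the span of the indicator vectors of the level-ball cosets `x + B_k`.** -/
theorem schwartzBruhat_eq_span_indBallCoset :
    schwartzBruhat L = Submodule.span ℂ (Set.range (indBallCoset L)) := by
  refine le_antisymm (Submodule.span_le.2 ?_) (Submodule.span_le.2 ?_)
  · rintro _ ⟨⟨A, hA, hAo⟩, rfl⟩
    exact indCO_mem_span_indBallCoset hA hAo
  · rintro _ ⟨p, rfl⟩
    exact indBallCoset_mem_schwartzBruhat p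

end Coeff

/-! ## §3  Factorizable boxes -/

variable (L) in
/-- the RESTRICTED BOX `{u ∈ X : u_v ∈ C_v for all v}` of a family of coordinate sets `C = (C_v)` -/
def rbox (C : ∀ i : SplitIdx L, Set (Coord L i)) : Set (Space L) := {u | ∀ i, u i ∈ C i}

/-- (Ported verbatim from the HodgeCMPerL package; no docstring in the source.) -/
theorem mem_rbox_iff {C : ∀ i : SplitIdx L, Set (Coord L i)} {u : Space L} :
    u ∈ rbox L C ↔ ∀ i, u i ∈ C i := Iff.rfl

variable (L) in
/-- a family of coordinate sets is FACTORIZABLE when every `C_v ⊆ (L⁺_v)³` is compact open and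
`C_v = 𝒪_v³` for all but finitely many `v` — the indexing data of a pure tensor `⊗_v 1_{C_v}` of the
restricted tensor product `⊗'_v 𝒮((L⁺_v)³)` -/
structure IsFactorizable (C : ∀ i : SplitIdx L, Set (Coord L i)) : Prop where
  isCompact : ∀ i, IsCompact (C i)
  isOpen : ∀ i, IsOpen (C i)
  eventually_eq : ∀ᶠ i in cofinite, C i = (cube L i : Set (Coord L i))

namespace IsFactorizable

variable {C : ∀ i : SplitIdx L, Set (Coord L i)}

/-- a factorizable box is open: finitely many open coordinate conditions cut out of the open set
`{u : u_v ∈ 𝒪_v³ at the remaining places}` -/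
theorem isOpen_rbox (hC : IsFactorizable L C) : IsOpen (rbox L C) := by
  have hT : {i : SplitIdx L | ¬ C i = (cube L i : Set (Coord L i))}.Finite :=
    Filter.eventually_cofinite.1 hC.eventually_eq
  have h : rbox L C = (⋂ i ∈ {i : SplitIdx L | ¬ C i = (cube L i : Set (Coord L i))},
      (fun u : Space L => u i) ⁻¹' C i) ∩
      {u : Space L | ∀ i, C i = (cube L i : Set (Coord L i)) → u.1 i ∈ (cube L i : Set (Coord L i))} := by
    ext u
    simp only [mem_rbox_iff, Set.mem_inter_iff, Set.mem_iInter, Set.mem_preimage, Set.mem_setOf_eq]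
    constructor
    · intro hu
      exact ⟨fun i _ => hu i, fun i hi => by rw [← hi]; exact hu i⟩
    · rintro ⟨h1, h2⟩ i
      by_cases hi : C i = (cube L i : Set (Coord L i))
      · rw [hi]; exact h2 i hi
      · exact h1 i hi
  rw [h]
  exact (hT.isOpen_biInter fun i _ => (hC.isOpen i).preimage (RestrictedProduct.continuous_eval i)).inter
    (RestrictedProduct.isOpen_forall_imp_mem (fact_isOpen_cube L).out)

/-- a factorizable box is compact: it is the continuous image of the compact space `∏_v C_v` through the
principal restricted product at the finitely many exceptional places -/
theorem isCompact_rbox (hC : IsFactorizable L C) : IsCompact (rbox L C) := by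
  haveI : ∀ i, CompactSpace (C i) := fun i => isCompact_iff_compactSpace.1 (hC.isCompact i)
  -- the principal piece at the cofinite set of unexceptional places
  have hS : (cofinite : Filter (SplitIdx L)) ≤ 𝓟 {i | C i = (cube L i : Set (Coord L i))} :=
    Filter.le_principal_iff.2 hC.eventually_eq
  let ΦS : (Π i, C i) → Πʳ i : SplitIdx L, [Coord L i, (cube L i : Set (Coord L i))]_[𝓟 {i |
      C i = (cube L i : Set (Coord L i))}] :=
    fun x => ⟨fun i => (x i : Coord L i), Filter.eventually_principal.2
      fun i (hi : C i = (cube L i : Set (Coord L i))) => by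
        show (x i : Coord L i) ∈ (cube L i : Set (Coord L i))
        rw [← hi]; exact (x i).2⟩
  have hΦS : Continuous ΦS := by
    rw [RestrictedProduct.isEmbedding_coe_of_principal.continuous_iff]
    exact continuous_pi fun i => continuous_subtype_val.comp (continuous_apply i)
  let Φ : (Π i, C i) → Space L := RestrictedProduct.inclusion _ _ hS ∘ ΦS
  have hΦ : Continuous Φ := (RestrictedProduct.continuous_inclusion hS).comp hΦS
  have hrange : Set.range Φ = rbox L C := by
    ext u
    constructor
    · rintro ⟨x, rfl⟩ i
      exact (x i).2
    · intro hu
      exact ⟨fun i => ⟨u i, hu i⟩, Subtype.ext <| funext fun _ => rfl⟩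
  rw [← hrange]
  exact isCompact_range hΦ

/-- the indicator vector of a factorizable box lies in `𝒮(X)` -/
theorem indCO_rbox_mem_schwartzBruhat (hC : IsFactorizable L C) :
    Coeff.indCO L (rbox L C) hC.isCompact_rbox hC.isOpen_rbox ∈ Coeff.schwartzBruhat L :=
  Submodule.subset_span ⟨⟨rbox L C, hC.isCompact_rbox, hC.isOpen_rbox⟩, rfl⟩

/-- **the indicator function of a factorizable box is the product of the local indicator functions**,
`1_{rbox C}(u) = ∏ᶠ_v 1_{C_v}(u_v)` — a finite product for `u ∈ X` (the factor is `1` wherever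
`u_v ∈ 𝒪_v³ = C_v`): the function-level dictionary with the pure tensor `⊗_v 1_{C_v}` -/
theorem indicator_rbox_apply (hC : IsFactorizable L C) (u : Space L) :
    (rbox L C).indicator (fun _ => (1 : ℂ)) u = ∏ᶠ i, (C i).indicator (fun _ => (1 : ℂ)) (u i) := by
  classical
  by_cases hu : u ∈ rbox L C
  · rw [Set.indicator_of_mem hu]
    exact (finprod_eq_one_of_forall_eq_one fun i => by rw [Set.indicator_of_mem (hu i)]).symm
  · rw [Set.indicator_of_notMem hu]
    obtain ⟨i, hi⟩ : ∃ i, u i ∉ C i := by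
      by_contra h
      exact hu fun i => not_not.1 fun hi => h ⟨i, hi⟩
    refine (finprod_eq_zero _ i (by rw [Set.indicator_of_notMem hi]) ?_).symm
    refine (Filter.eventually_cofinite.1 (hC.eventually_eq.and u.2)).subset fun j hj => ?_
    simp only [Function.mem_mulSupport] at hj
    intro hj'
    apply hj
    rw [Set.indicator_of_mem]
    rw [hj'.1]; exact hj'.2

end IsFactorizable

/-- **a level-ball coset is a restricted box**: `x + B_k = {u : dist(u_v, x_v) ≤ rad k v for all v}` -/
theorem ballCoset_eq_rbox (x : Space L) (k : ℕ) :
    ballCoset L x k = rbox L (fun i => closedBall (x i) (rad L k i)) := by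
  ext u
  constructor
  · rintro ⟨v, hv, rfl⟩ i
    rw [mem_closedBall, dist_eq_norm, RestrictedProduct.add_apply, add_sub_cancel_left]
    exact hv i
  · intro hu
    refine ⟨u - x, fun i => ?_, add_sub_cancel x u⟩
    rw [RestrictedProduct.sub_apply, ← dist_eq_norm]
    exact hu i

/-- **and that box is factorizable**: its factors are closed balls of positive radius (compact, and open
in the ultrametric `(L⁺_v)³`), equal to `𝒪_v³ = closedBall 0 1` at every place `v` of index `≥ k` with
`x_v ∈ 𝒪_v³` — all but finitely many. -/
theorem isFactorizable_closedBall (x : Space L) (k : ℕ) :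
    IsFactorizable L (fun i => closedBall (x i) (rad L k i)) where
  isCompact i := isCompact_closedBall _ _
  isOpen i := IsUltrametricDist.isOpen_closedBall (x i) (rad_pos L k i).ne'
  eventually_eq := by
    filter_upwards [x.2, (finite_enumIdx_lt L k).compl_mem_cofinite] with i hxi hik
    have hxi' : x i ∈ closedBall (0 : Coord L i) 1 := by
      rw [← coe_cube]; exact hxi
    rw [rad_of_not_lt hik, coe_cube]
    exact (IsUltrametricDist.closedBall_eq_of_mem hxi').symm

/-- the indicator vector of a coset is the indicator vector of a factorizable box -/
theorem Coeff.indBallCoset_eq_indCO_rbox (p : Space L × ℕ) :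
    Coeff.indBallCoset L p = Coeff.indCO L (rbox L (fun i => closedBall (p.1 i) (rad L p.2 i)))
      (isFactorizable_closedBall p.1 p.2).isCompact_rbox (isFactorizable_closedBall p.1 p.2).isOpen_rbox :=
  Coeff.indCO_congr (ballCoset_eq_rbox p.1 p.2) _ _ _ _

/-! ## §4  `𝒮(X)` is spanned by the indicator vectors of the factorizable boxes -/

namespace Coeff

variable (L) in
/-- the indicator vectors `1_{∏_v C_v}` of the factorizable boxes — the pure tensors `⊗_v 1_{C_v}` of
`⊗'_v 𝒮((L⁺_v)³)` read in `L²(X)` -/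
def indRBox (C : {C : ∀ i : SplitIdx L, Set (Coord L i) // IsFactorizable L C}) : Lp ℂ 2 (μ L) :=
  indCO L (rbox L C.1) C.2.isCompact_rbox C.2.isOpen_rbox

/-- (Ported verbatim from the HodgeCMPerL package; no docstring in the source.) -/
theorem indRBox_mem_schwartzBruhat (C : {C : ∀ i : SplitIdx L, Set (Coord L i) // IsFactorizable L C}) :
    indRBox L C ∈ schwartzBruhat L :=
  C.2.indCO_rbox_mem_schwartzBruhat

/-- as a function, `1_{∏_v C_v}` is (a.e.) the pure tensor `u ↦ ∏ᶠ_v 1_{C_v}(u_v)` -/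
theorem coeFn_indRBox (C : {C : ∀ i : SplitIdx L, Set (Coord L i) // IsFactorizable L C}) :
    (indRBox L C : Space L → ℂ) =ᵐ[μ L] fun u => ∏ᶠ i, (C.1 i).indicator (fun _ => (1 : ℂ)) (u i) := by
  have h : (indRBox L C : Space L → ℂ) =ᵐ[μ L] (rbox L C.1).indicator fun _ => (1 : ℂ) :=
    indicatorConstLp_coeFn (hs := C.2.isOpen_rbox.measurableSet)
      (hμs := C.2.isCompact_rbox.measure_lt_top.ne)
  exact h.trans (Filter.Eventually.of_forall fun u => C.2.indicator_rbox_apply u)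

variable (L) in
/-- **`𝒮(X) = span_ℂ {1_{∏_v C_v} : (C_v) factorizable}`** — the Schwartz–Bruhat space of the genuine
split Schrödinger model is spanned by the factorizable vectors; with
`GenuineSchrodingerSchwartzDense` (`𝒮(X)` = locally constant compactly supported functions, dense in
`L²(X)`) this is print's `𝒮(X) = ⊗'_v 𝒮((L⁺_v)³)` inside `L²(X)`. -/
theorem schwartzBruhat_eq_span_indRBox :
    schwartzBruhat L = Submodule.span ℂ (Set.range (indRBox L)) := by
  refine le_antisymm ?_ (Submodule.span_le.2 ?_)
  · rw [schwartzBruhat_eq_span_indBallCoset]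
    refine Submodule.span_le.2 ?_
    rintro _ ⟨p, rfl⟩
    rw [indBallCoset_eq_indCO_rbox]
    exact Submodule.subset_span ⟨⟨_, isFactorizable_closedBall p.1 p.2⟩, rfl⟩
  · rintro _ ⟨C, rfl⟩
    exact indRBox_mem_schwartzBruhat C


-- port_pkg: scope closed for this part
end Coeff
end HodgeCM.PerL34.PureTensor.SchrodingerModel
end
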